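import Summits.BirchSwinnertonDyer.BirchSwinnertonDyer.Theorems.KatoDescentPotSupersingularExactFineControlLocal
import Literature.NumberTheory.EllipticCurves.KatoFineSelmerDualMuProofs
import Literature.NumberTheory.EllipticCurves.IwasawaEulerCharRankZeroProofs
import HarnessLib

/-!
# EXACT FINE CONTROL at level `0`: `Sel_str(ℚ, W[p^∞]) ≅ Sel₀(ℚ_∞, W[p^∞])^Γ` on the rows with
# `W(ℚ_p)[p] = 0` — Kato's strict Selmer group of (14.9.3) IS the group of `Γ`-invariants of the fine
# Selmer group over the cyclotomic tower; hence `#Sel_str(ℚ, W[p^∞]) = #Sel₀(ℚ_∞, W[p^∞])^Γ = #(X₀)_Γ`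
# (clause (c2′) of the held core package 27962 on the tame rows, for the PINNED `𝐇²_Γ = X₀`; crux M 19196)

Seat `bsd-potss-rkm` g27 (prover, cell `bsd-potss`), `--supports stmt-BirchSwinnertonDyer-19196 --as helper`;
route-free; closes nothing.  HONEST FRAMING: BSD is not proved by any of this; nothing is booked; crux M
stays cite-level on {modularity, 27962}; theorems only (no definition, no named fact, no `sorry`).

## What and why

Memo FINDING-19196-rkm-g26 §3b: on every row of crux M with `W(ℚ_p)[p] = 0` (all (t′) rows at `p ≥ 11`;
`p ∈ {5,7}` off Kodaira II/III) Kato's `𝐇²_{Γ,loc}(T_pW) = 0`, so `𝐇²_Γ(T_pW) = X₀(W/ℚ_∞)` is the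
Pontryagin dual of the fine Selmer group `Sel₀(ℚ_∞, W[p^∞])`, and the count clause (c2′)
`#(𝐇²/X𝐇²)·#W(ℚ)[p^∞] = #Sel_str(ℚ,W[p^∞])·#W(ℚ_p)[p^∞]` of the held package
`Kato2004.exists_memberHullZetaCoreInputs` (item 27962) becomes `#(X₀)_Γ = #Sel_str(ℚ, W[p^∞])`,
`Sel_str = katoStrictSelmer W p {v_p}` (Kato (14.9.3): unramified off `p`, trivial at `p`).  THIS FILE PROVES
IT — for `p` odd, `κ` cyclotomic with generator `γ`, `W(ℚ_p)[p] = 0` — as the isomorphism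
`res : Sel_str(ℚ, W[p^∞]) ⥲ Sel₀(ℚ_∞, W[p^∞])^Γ` (`Γ`-invariants `= ker(conj_γ − 1) =
IwasawaDual.endInvariants (W.conjFineSelmerInfty κ γ - 1)`, the currency of g16's descent count):

* `mem_katoStrictSelmer_iff` (Kato's strict group read on the layer-`0` class),
  **`resH1Hom_kerSubgroup_mem_fineSelmerInfty_iff`** (`res y ∈ Sel₀(ℚ_∞) ⟺ y ∈ Sel_str(ℚ)`, from the
  local dictionary `ExactFineControlLocal.layerToInfty_mem_fineSelmerInfty_iff`),
  `resH1Hom_kerSubgroup_injective` (p659030 (a): `W(ℚ_∞)[p^∞] = 0`),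
  `exists_resH1Hom_kerSubgroup_eq_of_conjH1_eq` (onto `Γ`-invariants: Greenberg's Lemma 3.2, tree
  `ZpExtension.mem_range_resOfLe_of_conjH1_eq`);
* **`exists_addEquiv_katoStrictSelmer_fineSelmerInfty_invariants`** — the isomorphism;
  **`natCard_katoStrictSelmer_eq_natCard_fineSelmerInfty_invariants`** — `#Sel_str(ℚ,W[p^∞]) = #Sel₀(ℚ_∞,W[p^∞])^Γ`;
  **`natCard_coinvariants_fineSelmerDual_eq_natCard_katoStrictSelmer`** — the Pontryagin form
  `#(X₀/TX₀) = #Sel_str(ℚ, W[p^∞])` for EVERY dual fine Selmer datum (`FineSelmerDualData.isDualPair`,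
  `IsDualPair.natCard_coinvariants`);
* §5 the clause itself: `#W(ℚ)[p^∞] = #W(ℚ_{v_p})[p^∞] = 1` from `W(ℚ_p)[p] = 0`, so
  `katoH2CountAt_iff_eq_natCard_katoStrictSelmer` (`KatoH2CountAt W p n ↔ n = #Sel_str`) and
  **`katoH2CountAt_natCard_coinvariants_fineSelmerDual`** — `KatoH2CountAt W p #(X₀)_Γ`: clause (c2′) of the held
  package for the pinned `X₀ = 𝐇²_Γ`, as a KERNEL theorem on these rows.

References: K. Kato, Astérisque 295 (2004), §8.2, §14.1, (14.9.3) p. 240, (14.14.2) p. 243 [Kato2004Asterisque];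
R. Greenberg, LNM 1716 (1999), §3 Lemmas 3.1–3.3, Prop. 3.8 (pp. 86–96) [GreenbergLNM1716]; R. Greenberg,
*Iwasawa theory for p-adic representations* (1989) §1 p. 98 [Greenberg1989]; J. Coates, R. Sujatha,
Math. Ann. 331 (2005) §3 [CoatesSujatha2005]; J. Coates, P. Schneider, R. Sujatha, Doc. Math. Extra Vol. Kato
(2003) §3 (30) [CoatesSchneiderSujatha2003].
-/

-- the summit and its single problem are both named `BirchSwinnertonDyer` (registry layout D-0017)
set_option linter.dupNamespace false
set_option autoImplicit false

noncomputable section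

open scoped Classical NumberField
open Function Field NumberField IsDedekindDomain
open Literature.NumberTheory.EllipticCurves Literature.NumberTheory.EllipticCurves.GreenbergSelmer
  Literature.NumberTheory.EllipticCurves.ZpExtension Literature.NumberTheory.EllipticCurves.Kato2004
  Literature.NumberTheory.GaloisRepresentations
open Summit.BirchSwinnertonDyer.BirchSwinnertonDyer.Theorems
  Summit.BirchSwinnertonDyer.BirchSwinnertonDyer.Theorems.FineSelmerLeSignedSelmer
  Summit.BirchSwinnertonDyer.BirchSwinnertonDyer.Theorems.ExactFineControlLocal

universe u

namespace Summit.BirchSwinnertonDyer.BirchSwinnertonDyer.Theorems.ExactFineControl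

section Rat

variable (W : WeierstrassCurve ℚ) [W.IsElliptic] {p : ℕ} [hp : Fact p.Prime] (κ : ZpExtension ℚ p)

/-! ## §4 EXACT FINE CONTROL: `Sel_str(ℚ, W[p^∞]) ≅ Sel₀(ℚ_∞, W[p^∞])^Γ`, and the counts -/

omit [W.IsElliptic] in
/-- Restriction `H¹(ℚ, W[p^∞]) → H¹(ℚ_∞, W[p^∞])` factors through the layer-`0` group `H¹(κ⁻¹(ℤ_p), ·)`.
[cite: SerreGaloisCohomology1997, I.§2.4] -/
theorem resH1Hom_kerSubgroup_eq_layerToInfty (y : W.galH1Primary p) :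
    resH1Hom (Literature.NumberTheory.EllipticCurves.subgroupIncl κ.kerSubgroup)
        (AddMonoidHom.id (W.geomPrimaryTorsion p)) (fun _ _ ↦ rfl) y =
      W.layerToInfty κ 0 (resH1Hom (Literature.NumberTheory.EllipticCurves.subgroupIncl (κ.layerSubgroup 0))
        (AddMonoidHom.id (W.geomPrimaryTorsion p)) (fun _ _ ↦ rfl) y) :=
  (resOfLe_resH1Hom_subgroupIncl (κ.kerSubgroup_le_layerSubgroup 0) y).symm

omit [W.IsElliptic] in
/-- `H¹(Γ_ℚ, W[p^∞]) → H¹(κ⁻¹(ℤ_p), W[p^∞])` is bijective (`κ⁻¹(ℤ_p) = Γ_ℚ`). [cite: SerreGaloisCohomology1997, I.§2.4] -/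
theorem bijective_resH1Hom_layerSubgroup_zero :
    Function.Bijective (resH1Hom (Literature.NumberTheory.EllipticCurves.subgroupIncl (κ.layerSubgroup 0))
      (AddMonoidHom.id (W.geomPrimaryTorsion p)) (fun _ _ ↦ rfl)) :=
  bijective_resH1Hom_subgroupIncl _ (κ.layerSubgroup 0) fun g ↦ le_layerSubgroup_zero κ ⊤ (Subgroup.mem_top g)

omit [W.IsElliptic] in
/-- **Membership in Kato's strict Selmer group, read on the layer-`0` class**: `y ∈ Sel_str(ℚ, W[p^∞])`
(`katoStrictSelmer W p {v_p}`) iff the restriction of `y` to `D_p` vanishes and its restriction to `I_v`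
vanishes for every `v ≠ v_p` (`I_v = I_{𝔓₀(v)}`, `inertia_adicCompletionPrime_eq_map_absInertia`).
[cite: Kato2004Asterisque, §8.2 (p. 181), §14.1 (p. 235) and (14.9.3) (p. 240)] -/
theorem mem_katoStrictSelmer_iff (y : W.galH1Primary p) :
    y ∈ katoStrictSelmer W p {primePlace p} ↔
      W.resOfLe p (le_layerSubgroup_zero κ (decomp (primePlace p)))
          (resH1Hom (Literature.NumberTheory.EllipticCurves.subgroupIncl (κ.layerSubgroup 0))
            (AddMonoidHom.id (W.geomPrimaryTorsion p)) (fun _ _ ↦ rfl) y) = 0 ∧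
        ∀ v : HeightOneSpectrum (𝓞 ℚ), v ≠ primePlace p →
          W.resOfLe p (le_layerSubgroup_zero κ (GreenbergSelmer.inertia v))
            (resH1Hom (Literature.NumberTheory.EllipticCurves.subgroupIncl (κ.layerSubgroup 0))
              (AddMonoidHom.id (W.geomPrimaryTorsion p)) (fun _ _ ↦ rfl) y) = 0 := by
  have e : ∀ v : HeightOneSpectrum (𝓞 ℚ), unramifiedKer (W.geomPrimaryTorsion p) (adicCompletionPrime ℚ v) =
      subgroupResKer (W.geomPrimaryTorsion p) (GreenbergSelmer.inertia v) := fun v ↦ by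
    change subgroupResKer _ ((adicCompletionPrime ℚ v).inertia (absoluteGaloisGroup ℚ)) = _
    rw [inertia_adicCompletionPrime_eq_map_absInertia]; rfl
  simp only [katoStrictSelmer, AddSubgroup.mem_inf, AddSubgroup.mem_iInf, Set.mem_singleton_iff]
  constructor
  · rintro ⟨h1, h2⟩
    refine ⟨?_, fun v hv ↦ ?_⟩
    · exact (resOfLe_resH1Hom_subgroupIncl _ y).trans ((mem_subgroupResKer_iff _ y).1 (h1 _ rfl))
    · have h := h2 v hv
      rw [e, mem_subgroupResKer_iff] at h
      exact (resOfLe_resH1Hom_subgroupIncl _ y).trans h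
  · rintro ⟨h1, h2⟩
    refine ⟨fun v hv ↦ ?_, fun v hv ↦ ?_⟩
    · subst hv
      exact (mem_subgroupResKer_iff _ y).2 ((resOfLe_resH1Hom_subgroupIncl _ y).symm.trans h1)
    · rw [e, mem_subgroupResKer_iff]
      exact (resOfLe_resH1Hom_subgroupIncl _ y).symm.trans (h2 v hv)

/-- **EXACT FINE CONTROL, membership form.** For `p` odd, `κ` cyclotomic, `W(ℚ_p)[p] = 0`: the restriction
to `ℚ_∞` of `y ∈ H¹(ℚ, W[p^∞])` lies in `Sel₀(ℚ_∞, W[p^∞])` iff `y ∈ Sel_str(ℚ, W[p^∞])`.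
[cite: Kato2004Asterisque, (14.9.3) (p. 240) and (14.14.2) (p. 243)] [cite: GreenbergLNM1716, Prop. 3.8 (pp. 95–96)] -/
theorem resH1Hom_kerSubgroup_mem_fineSelmerInfty_iff (hp2 : p ≠ 2) (hκ : κ.IsCyclotomic)
    (h4 : ∀ R : (W.baseChange ℚ_[p]).toAffine.Point, p • R = 0 → R = 0) (y : W.galH1Primary p) :
    resH1Hom (Literature.NumberTheory.EllipticCurves.subgroupIncl κ.kerSubgroup)
        (AddMonoidHom.id (W.geomPrimaryTorsion p)) (fun _ _ ↦ rfl) y ∈ W.fineSelmerInfty κ ↔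
      y ∈ katoStrictSelmer W p {primePlace p} := by
  rw [resH1Hom_kerSubgroup_eq_layerToInfty, layerToInfty_mem_fineSelmerInfty_iff W κ hp2 hκ h4,
    mem_katoStrictSelmer_iff W κ]

/-- **EXACT FINE CONTROL, injectivity**: `H¹(ℚ, W[p^∞]) → H¹(ℚ_∞, W[p^∞])` is injective when `W(ℚ_p)[p] = 0`
(p659030 (a)). [cite: GreenbergLNM1716, §3 Lemma 3.1 (p. 86)] -/
theorem resH1Hom_kerSubgroup_injective (h4 : ∀ R : (W.baseChange ℚ_[p]).toAffine.Point, p • R = 0 → R = 0) :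
    Function.Injective (resH1Hom (Literature.NumberTheory.EllipticCurves.subgroupIncl κ.kerSubgroup)
      (AddMonoidHom.id (W.geomPrimaryTorsion p)) (fun _ _ ↦ rfl)) := by
  intro y y' h
  rw [resH1Hom_kerSubgroup_eq_layerToInfty, resH1Hom_kerSubgroup_eq_layerToInfty] at h
  have hinj := TowerFineControl.resOfLe_kerSubgroup_injective_of_noPTorsionPadic W p κ
    (κ.kerSubgroup_le_layerSubgroup 0) (primePlace p) (coe_primesEquiv_primePlace p) h4
  exact (bijective_resH1Hom_layerSubgroup_zero W κ).1 (hinj h)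

omit [W.IsElliptic] in
/-- **EXACT FINE CONTROL, surjectivity onto `Γ`-invariants**: every `γ`-fixed class of `H¹(ℚ_∞, W[p^∞])` is a
restriction from `ℚ` (Greenberg's Lemma 3.2 at `n = 0`, `cd_p ℤ_p = 1`). [cite: GreenbergLNM1716, §3 Lemma 3.2 (p. 87)] -/
theorem exists_resH1Hom_kerSubgroup_eq_of_conjH1_eq {γ : absoluteGaloisGroup ℚ} (hγ : κ.IsTopGenerator γ)
    (c : W.subgroupH1 p κ.kerSubgroup) (hc : W.conjH1 p κ.kerSubgroup γ c = c) :
    ∃ y : W.galH1Primary p, resH1Hom (Literature.NumberTheory.EllipticCurves.subgroupIncl κ.kerSubgroup)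
      (AddMonoidHom.id (W.geomPrimaryTorsion p)) (fun _ _ ↦ rfl) y = c := by
  have hfix : W.conjH1 p κ.kerSubgroup (γ ^ p ^ 0) c = c := by rwa [pow_zero, pow_one]
  obtain ⟨y₀, hy₀⟩ := ZpExtension.mem_range_resOfLe_of_conjH1_eq κ hγ 0
    (W.continuous_smul_geomPrimaryTorsion p) (exists_pow_smul_geomPrimaryTorsion_eq_zero W) c hfix
  obtain ⟨y, hy⟩ := (bijective_resH1Hom_layerSubgroup_zero W κ).2 y₀
  refine ⟨y, ?_⟩
  rw [resH1Hom_kerSubgroup_eq_layerToInfty, hy]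
  exact hy₀

/-- **EXACT FINE CONTROL at level `0` (the isomorphism).** `W/ℚ` elliptic, `p` an odd prime, `κ` the
cyclotomic `ℤ_p`-extension with topological generator `γ`, and `W(ℚ_p)[p] = 0`.  Then restriction to `ℚ_∞`
is an isomorphism of Kato's strict Selmer group `Sel_str(ℚ, W[p^∞]) = Ker(H¹(ℤ[1/p], W[p^∞]) → H¹(ℚ_p, W[p^∞]))`
onto the `Γ`-invariants `Sel₀(ℚ_∞, W[p^∞])^Γ = ker(conj_γ − 1)` of the fine Selmer group.
[cite: GreenbergLNM1716, Prop. 3.8 (pp. 95–96) and §3 Lemmas 3.1–3.3] [cite: Kato2004Asterisque, (14.9.3) (p. 240), (14.14.2) (p. 243)]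
[cite: GreenbergVatsal2000, §2 Prop. (2.4)] -/
theorem exists_addEquiv_katoStrictSelmer_fineSelmerInfty_invariants (hp2 : p ≠ 2) (hκ : κ.IsCyclotomic)
    {γ : absoluteGaloisGroup ℚ} (hγ : κ.IsTopGenerator γ)
    (h4 : ∀ R : (W.baseChange ℚ_[p]).toAffine.Point, p • R = 0 → R = 0) :
    ∃ e : katoStrictSelmer W p {primePlace p} ≃+ IwasawaDual.endInvariants (W.conjFineSelmerInfty κ γ - 1),
      ∀ y, (((e y : IwasawaDual.endInvariants (W.conjFineSelmerInfty κ γ - 1)) : W.fineSelmerInfty κ) :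
          W.subgroupH1 p κ.kerSubgroup) =
        resH1Hom (Literature.NumberTheory.EllipticCurves.subgroupIncl κ.kerSubgroup)
          (AddMonoidHom.id (W.geomPrimaryTorsion p)) (fun _ _ ↦ rfl) y := by
  set r := resH1Hom (Literature.NumberTheory.EllipticCurves.subgroupIncl κ.kerSubgroup)
    (AddMonoidHom.id (W.geomPrimaryTorsion p)) (fun _ _ ↦ rfl) with hr
  have hmem : ∀ y : katoStrictSelmer W p {primePlace p}, r y ∈ W.fineSelmerInfty κ := fun y ↦
    (resH1Hom_kerSubgroup_mem_fineSelmerInfty_iff W κ hp2 hκ h4 y).2 y.2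
  have hinv : ∀ y : katoStrictSelmer W p {primePlace p},
      (⟨r y, hmem y⟩ : W.fineSelmerInfty κ) ∈ IwasawaDual.endInvariants (W.conjFineSelmerInfty κ γ - 1) := by
    intro y
    rw [IwasawaDual.mem_endInvariants_iff]
    apply Subtype.ext
    rw [WeierstrassCurve.coe_conjFineSelmerInfty_sub_one_apply, ZeroMemClass.coe_zero, sub_eq_zero]
    change W.conjH1 p κ.kerSubgroup γ (r y) = r y
    rw [hr, resH1Hom_kerSubgroup_eq_layerToInfty]
    exact conjH1_layerToInfty_zero W κ γ _
  let f : katoStrictSelmer W p {primePlace p} →+ IwasawaDual.endInvariants (W.conjFineSelmerInfty κ γ - 1) :=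
    { toFun := fun y ↦ ⟨⟨r y, hmem y⟩, hinv y⟩
      map_zero' := Subtype.ext (Subtype.ext (by simp))
      map_add' := fun y y' ↦ Subtype.ext (Subtype.ext (by simp)) }
  refine ⟨AddEquiv.ofBijective f ⟨fun y y' h ↦ ?_, fun s ↦ ?_⟩, fun y ↦ rfl⟩
  · have h' := congrArg (fun s : IwasawaDual.endInvariants (W.conjFineSelmerInfty κ γ - 1) ↦
      ((s : W.fineSelmerInfty κ) : W.subgroupH1 p κ.kerSubgroup)) h
    exact Subtype.ext (resH1Hom_kerSubgroup_injective W κ h4 h')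
  · have hs : W.conjH1 p κ.kerSubgroup γ ((s : W.fineSelmerInfty κ) : W.subgroupH1 p κ.kerSubgroup) =
        (s : W.fineSelmerInfty κ) := by
      have h0 := (IwasawaDual.mem_endInvariants_iff _ _).1 s.2
      have h1 := congrArg (fun t : W.fineSelmerInfty κ ↦ (t : W.subgroupH1 p κ.kerSubgroup)) h0
      simp only [WeierstrassCurve.coe_conjFineSelmerInfty_sub_one_apply, ZeroMemClass.coe_zero,
        sub_eq_zero] at h1
      exact h1
    obtain ⟨y, hy⟩ := exists_resH1Hom_kerSubgroup_eq_of_conjH1_eq W κ hγ _ hs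
    have hyS : y ∈ katoStrictSelmer W p {primePlace p} :=
      (resH1Hom_kerSubgroup_mem_fineSelmerInfty_iff W κ hp2 hκ h4 y).1 (hy ▸ (s : W.fineSelmerInfty κ).2)
    exact ⟨⟨y, hyS⟩, Subtype.ext (Subtype.ext hy)⟩

/-- **EXACT FINE CONTROL, the count: `#Sel_str(ℚ, W[p^∞]) = #Sel₀(ℚ_∞, W[p^∞])^Γ`** (`p` odd, `κ`
cyclotomic with generator `γ`, `W(ℚ_p)[p] = 0`; `Nat.card`, both sides finite or both infinite).
[cite: Kato2004Asterisque, (14.9.3) (p. 240), (14.14.2) (p. 243)] [cite: GreenbergLNM1716, Prop. 3.8 (pp. 95–96)] -/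
theorem natCard_katoStrictSelmer_eq_natCard_fineSelmerInfty_invariants (hp2 : p ≠ 2) (hκ : κ.IsCyclotomic)
    {γ : absoluteGaloisGroup ℚ} (hγ : κ.IsTopGenerator γ)
    (h4 : ∀ R : (W.baseChange ℚ_[p]).toAffine.Point, p • R = 0 → R = 0) :
    Nat.card (katoStrictSelmer W p {primePlace p}) =
      Nat.card (IwasawaDual.endInvariants (W.conjFineSelmerInfty κ γ - 1)) := by
  obtain ⟨e, -⟩ := exists_addEquiv_katoStrictSelmer_fineSelmerInfty_invariants W κ hp2 hκ hγ h4
  exact Nat.card_congr e.toEquiv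

/-- **The Pontryagin form: `#(X₀)_Γ = #Sel_str(ℚ, W[p^∞])`** for EVERY dual fine Selmer datum `X₀ = Y.X`
(`(X₀)_Γ = X₀/TX₀`, `IwasawaAlgebra.coinvariants`): on the rows with `W(ℚ_p)[p] = 0` (where Kato's
`𝐇²_Γ(T_pW) = X₀(W/ℚ_∞)` and `W(ℚ)[p^∞] = W(ℚ_p)[p^∞] = 0`) this is the count clause (c2′)
`#(𝐇²/X𝐇²)·#W(ℚ)[p^∞] = #Sel_str·#W(ℚ_p)[p^∞]` of the held core package for the PINNED `𝐇²_Γ = X₀`.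
[cite: Kato2004Asterisque, (14.9.3) (p. 240) and §14.14 (14.14.2) (p. 243)] [cite: GreenbergLNM1716, §1 p. 60 and Prop. 3.8] -/
theorem natCard_coinvariants_fineSelmerDual_eq_natCard_katoStrictSelmer (hp2 : p ≠ 2) (hκ : κ.IsCyclotomic)
    {γ : absoluteGaloisGroup ℚ} (hγ : κ.IsTopGenerator γ)
    (h4 : ∀ R : (W.baseChange ℚ_[p]).toAffine.Point, p • R = 0 → R = 0) (Y : W.FineSelmerDualData κ γ) :
    Nat.card (IwasawaAlgebra.coinvariants p Y.X) = Nat.card (katoStrictSelmer W p {primePlace p}) := by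
  rw [(Y.isDualPair hγ).natCard_coinvariants,
    natCard_katoStrictSelmer_eq_natCard_fineSelmerInfty_invariants W κ hp2 hκ hγ h4]


/-! ## §5 The clause (c2′) itself on these rows: `KatoH2CountAt W p n ↔ n = #Sel_str(ℚ, W[p^∞])` -/

omit [W.IsElliptic] hp in
/-- An abelian group without `p`-torsion has trivial `p`-primary component. [folklore] -/
theorem primaryComponent_eq_bot_of_noPTorsion {A : Type*} [AddCommGroup A] [Fact p.Prime]
    (h : ∀ a : A, p • a = 0 → a = 0) : AddCommGroup.primaryComponent A p = ⊥ := by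
  rw [eq_bot_iff]
  intro a ha
  obtain ⟨k, hk⟩ := (AddCommGroup.mem_primaryComponent (G := A) (p := p)).1 ha
  rw [AddSubgroup.mem_bot]
  clear ha
  induction k generalizing a with
  | zero => simpa using hk
  | succ k ih =>
    apply h
    exact ih (by rw [← mul_smul, ← pow_succ]; exact hk)

omit [W.IsElliptic] in
/-- **`W(ℚ_p)[p] = 0 ⟹ #W(ℚ)[p^∞] = 1`** (`W(ℚ) ↪ W(ℚ_p)`). [cite: SilvermanAEC2009, VII.§3 Prop. 3.1 (shape)] -/
theorem natCard_primaryComponent_point_eq_one_of_noPTorsionPadic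
    (h4 : ∀ R : (W.baseChange ℚ_[p]).toAffine.Point, p • R = 0 → R = 0) :
    Nat.card (AddCommGroup.primaryComponent W.toAffine.Point p) = 1 := by
  let ι : W.toAffine.Point →+ (W.baseChange ℚ_[p]).toAffine.Point :=
    WeierstrassCurve.Affine.Point.baseChange (W' := W.toAffine) ℚ ℚ_[p]
  have hι : Function.Injective ι := WeierstrassCurve.Affine.Point.map_injective _
  have h : ∀ R : W.toAffine.Point, p • R = 0 → R = 0 := fun R hR ↦
    hι (by rw [map_zero]; exact h4 (ι R) (by rw [← map_nsmul, hR, map_zero]))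
  rw [primaryComponent_eq_bot_of_noPTorsion h, AddSubgroup.card_bot]

omit [W.IsElliptic] in
/-- **`W(ℚ_p)[p] = 0 ⟹ #W(ℚ_v)[p^∞] = 1`** at the place `v = v_p` (`ℚ_v ≃ ℚ_p`, p657752 §1).
[cite: SilvermanAEC2009, VII.§3 Prop. 3.1 (shape)] -/
theorem natCard_primaryComponent_point_adicCompletion_eq_one_of_noPTorsionPadic
    (h4 : ∀ R : (W.baseChange ℚ_[p]).toAffine.Point, p • R = 0 → R = 0) :
    Nat.card (AddCommGroup.primaryComponent
      (W.baseChange ((primePlace p).adicCompletion ℚ)).toAffine.Point p) = 1 := by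
  rw [primaryComponent_eq_bot_of_noPTorsion (TowerTorsionVanishing.noPTorsion_adicCompletion_of_padic W p
    (primePlace p) (coe_primesEquiv_primePlace p) h4), AddSubgroup.card_bot]

omit [W.IsElliptic] in
/-- **On the rows with `W(ℚ_p)[p] = 0` the count clause (c2′) pins `n`: `KatoH2CountAt W p n ↔ n = #Sel_str(ℚ, W[p^∞])`**
(both `p`-primary point groups in (14.9.3) are trivial there).
[cite: Kato2004Asterisque, (14.9.3) (p. 240) and (14.14.2) (p. 243)] -/
theorem katoH2CountAt_iff_eq_natCard_katoStrictSelmer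
    (h4 : ∀ R : (W.baseChange ℚ_[p]).toAffine.Point, p • R = 0 → R = 0) (n : ℕ) :
    KatoH2CountAt W p n ↔ n = Nat.card (katoStrictSelmer W p {primePlace p}) := by
  rw [katoH2CountAt_iff, natCard_primaryComponent_point_eq_one_of_noPTorsionPadic W h4,
    natCard_primaryComponent_point_adicCompletion_eq_one_of_noPTorsionPadic W h4, mul_one, mul_one]

/-- **Clause (c2′) for the PINNED `X₀` on the rows with `W(ℚ_p)[p] = 0`: `KatoH2CountAt W p #(X₀)_Γ`** —
`#(X₀/TX₀)·#W(ℚ)[p^∞] = #Sel_str(ℚ, W[p^∞])·#W(ℚ_p)[p^∞]` for EVERY dual fine Selmer datum `X₀ = Y.X`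
(`p` odd, `κ` cyclotomic with generator `γ`).  There Kato's `𝐇²_Γ(T_pW) = X₀(W/ℚ_∞)` (memo FINDING-19196-rkm-g26
§3b), so this is the count clause of the held core package 27962 for Kato's own object, as a KERNEL theorem.
[cite: Kato2004Asterisque, (14.9.3) (p. 240), §14.14 (14.14.2) (p. 243) and proof of Prop. 14.16 (p. 245)]
[cite: GreenbergLNM1716, Prop. 3.8 (pp. 95–96)] -/
theorem katoH2CountAt_natCard_coinvariants_fineSelmerDual (hp2 : p ≠ 2) (hκ : κ.IsCyclotomic)
    {γ : absoluteGaloisGroup ℚ} (hγ : κ.IsTopGenerator γ)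
    (h4 : ∀ R : (W.baseChange ℚ_[p]).toAffine.Point, p • R = 0 → R = 0) (Y : W.FineSelmerDualData κ γ) :
    KatoH2CountAt W p (Nat.card (IwasawaAlgebra.coinvariants p Y.X)) :=
  (katoH2CountAt_iff_eq_natCard_katoStrictSelmer W h4 _).2
    (natCard_coinvariants_fineSelmerDual_eq_natCard_katoStrictSelmer W κ hp2 hκ hγ h4 Y)

end Rat

end Summit.BirchSwinnertonDyer.BirchSwinnertonDyer.Theorems.ExactFineControl

end
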